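import Mathlib
import HarnessLib
import Summits.HubbardSuperconductivity.HubbardSuperconductivity.Theorems.KLProgrammeKLRegimeEngineFrameShiftDressingFactorTablesG
import Literature.MathematicalPhysics.QuantumLattice.HubbardUVSymbolDefectJetsGevreySmall

/-!
# K3 gen-8-FLOW (stmt 20437, stub (C), «(C)-B-LAST-SIZE» step (S1)): the δ-CARRYING DEFECT TABLE at the flow frames (last-scale regime)

Cell gate-hubbard-kl, seat p2 g16.  The Gevrey flow table of the defect factor `d = Ψ̃ − Ψ₁`
(`…FrameShiftDressingFactorTablesG.norm_iteratedFDeriv_defect_flowFrame_le_gevrey`, p585557) is the TRIANGLE bound `‖DᵏΨ̃‖ + ‖DᵏΨ₁‖`: it does not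
carry the frame mismatch `δ = Gfr₀|U|Θ·16^{−m}` although `d = O(v)`.  At the last flow step (`m = n_β`: `Λ_m ∈ [π/β, 4π/β)`, reading frequencies
`ω = ±π/β`, so `Λ_m/4 ≤ |ω|`) the Literature lemma `HubbardUVSymbolDefectJetsGevreySmall.norm_iteratedFDeriv_defect_le_gevrey_small` supplies the
δ-carrying row; this file instantiates it at the flow frames `K_m → K_{m+1}` with the parametrised envelopes `E_u = 4 + 4^mΞ`, `F_v = 2^{10}Φ4^m`,
`δ = Gfr₀|U|Θ16^{−m}` of the v2 tables:

* **`norm_iteratedFDeriv_defect_flowFrame_le_gevrey_small`** — under the extra hypothesis `Λ_m/4 ≤ |ω|` (and the Gevrey cutoff table up to order `k+1`):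
  `‖Dᵏd(q)‖ ≤ δ·X₀|c|(4/Λ_m)((X₀+1)(4/Λ_m) + 16(1+C_χ)/Λ_m)·(k!)²·(2ρ_d(m))ᵏ`, `ρ_d` the explicit ratio of the Literature lemma at the flow envelopes.

This is the row the graded last-step door (`…SupFlowGradedTablesGN`) should read for its defect Leibniz summands at `m = n_β` (successor: the `_small`
numeral twin).  Proof = one application; no definitions; nothing asserts superconductivity.  References: BGM 2006 §2.3 (2.23), (2.27)–(2.28)
[cite: BenfattoGiulianiMastropietro2006].
-/

noncomputable section

namespace Summit.HubbardSuperconductivity.HubbardSuperconductivity.Theorems.EngineV8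

set_option linter.dupNamespace false -- summit = problem name (single-conjunct summit), D-0017

open Real Finset Literature.MathematicalPhysics.QuantumLattice Literature.Probability.LatticeModels
open Summit.HubbardSuperconductivity.HubbardSuperconductivity.Theorems.KLRegimeSplit
open Summit.HubbardSuperconductivity.HubbardSuperconductivity.Theorems.DispersionFlow
open Summit.HubbardSuperconductivity.HubbardSuperconductivity.Theorems.KLProgrammeLegKernels
open scoped Nat

variable {L M : ℕ} [NeZero L] [NeZero M]

section Tables

omit [NeZero L] [NeZero M] in
/-- `0 < Λ_m`. -/
private theorem klScale_pos_small (m : ℕ) : 0 < (klScale klE0 m) := by unfold klScale klE0; positivity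

variable {G : GeoConsts} {Q : EngConsts} {R : RenConsts} (hR : ∀ j, 0 ≤ R.Gfr j) (hGS : ∀ k, 0 ≤ G.S k) (hQS : ∀ k, 0 ≤ Q.S' k)
  {β U μ : ℝ} (hμ : μ ∈ klWindowC) {X₄ : ℝ} (hX4 : ∀ l ≤ 4, ∀ x : ℝ, ‖iteratedFDeriv ℝ l salmhoferCutoff x‖ ≤ X₄)
  {N : ℕ} {X₀ Cχ : ℝ} (hX1 : 1 ≤ X₀) (hC : 0 ≤ Cχ) (hXG : ∀ l ≤ N, ∀ x : ℝ, ‖iteratedFDeriv ℝ l salmhoferCutoff x‖ ≤ X₀ * ((l ! : ℝ)) ^ 2 * Cχ ^ l)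
  {n : ℕ} (hP : ∀ m ≤ n, FlowPieceJetsAt L M β U μ R m) (hT : ∀ m ≤ n, TwoLegReadJetsF L M G Q β U μ m) {m : ℕ} (hmn : m ≤ n)
  {Ξ Θ Φ : ℝ} (hΞ0 : 0 ≤ Ξ) (hΘ0 : 0 ≤ Θ) (hΦ0 : 0 ≤ Φ) (hΞ : ∀ i, 1 ≤ i → (if i ≤ 4 then R.Gfr i * uPow i U
      else 2 ^ i * (Real.pi ^ 8 / 4 * 2 ^ (i - 1) * (2 : ℝ) ^ (8 * (i - 1))) *
        ((curveExtC X₄ G.S 1 + curveExtC X₄ Q.S' 1 * |U|) * U ^ 2)) ≤ i ! * Ξ ^ i)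
  (hΘΦ : ∀ i : ℕ, (if i ≤ 4 then R.Gfr i * uPow i U
      else 2 ^ i * (Real.pi ^ 8 / 4 * 2 ^ (i - 1) * (2 : ℝ) ^ (8 * (i - 1))) *
        ((curveExtC X₄ G.S 1 + curveExtC X₄ Q.S' 1 * |U|) * U ^ 2)) ≤ R.Gfr 0 * |U| * Θ * i ! * (2 ^ 10 * Φ) ^ i)
  {ω : ℝ} (hωΛ : (klScale klE0 m) / 4 ≤ |ω|) (c : ℝ)
include hR hGS hQS hμ hX4 hX1 hC hXG hP hT hmn hΞ0 hΘ0 hΦ0 hΞ hΘΦ hωΛ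

/-- **TABLE (defect), δ-CARRYING, last-scale regime `Λ_m/4 ≤ |ω|`** (Gevrey table up to order `k+1`). [cite: BenfattoGiulianiMastropietro2006, §2.3 (2.27)–(2.28)] -/
theorem norm_iteratedFDeriv_defect_flowFrame_le_gevrey_small {k : ℕ} (hk : k + 1 ≤ N) (q : Momentum) :
    ‖iteratedFDeriv ℝ k (fun q : Momentum => ((uvWeightFn (klScale klE0 m) ω (frameLevel μ (klFlowFrameU L M β U μ (m + 1)) q) : ℝ) : ℂ) * resolventFnXi c 0 ω (frameLevel μ (klFlowFrameU L M β U μ (m + 1)) q + uvWeightFn (klScale klE0 m) ω (frameLevel μ (klFlowFrameU L M β U μ (m + 1)) q) * evalM (fsub (klFlowFrameU L M β U μ (m + 1)) (klFlowFrameU L M β U μ m)) q) - uvSymbolFnXi c (klScale klE0 m) ω (frameLevel μ (klFlowFrameU L M β U μ (m + 1)) q + evalM (fsub (klFlowFrameU L M β U μ (m + 1)) (klFlowFrameU L M β U μ m)) q)) q‖ ≤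
      (R.Gfr 0 * |U| * Θ * ((16 : ℝ) ^ m)⁻¹) * (X₀ * (|c| * (4 / (klScale klE0 m))) * ((X₀ + 1) * (4 / (klScale klE0 m)) + 16 * (1 + Cχ) / (klScale klE0 m))) * ((k ! : ℝ)) ^ 2 *
        (2 * (4 * (4 * ((4 + (4 : ℝ) ^ m * Ξ) + (2 ^ 10 * Φ * (4 : ℝ) ^ m)) * (1 + (16 * (1 + Cχ) / (klScale klE0 m)) * (1 + (R.Gfr 0 * |U| * Θ * ((16 : ℝ) ^ m)⁻¹)))) + 4 * (4 * (2 * (4 * (4 + (4 : ℝ) ^ m * Ξ) * (1 + 16 * (1 + Cχ) / (klScale klE0 m) * 1) + (2 ^ 10 * Φ * (4 : ℝ) ^ m))) * (1 + (4 / (klScale klE0 m)) * (1 + (R.Gfr 0 * |U| * Θ * ((16 : ℝ) ^ m)⁻¹) + ((klScale klE0 m) / 128 + X₀ * (R.Gfr 0 * |U| * Θ * ((16 : ℝ) ^ m)⁻¹))))) + (4 * ((4 + (4 : ℝ) ^ m * Ξ) + (2 ^ 10 * Φ * (4 : ℝ) ^ m)) * (1 + (4 / (klScale klE0 m)) * (1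 + (R.Gfr 0 * |U| * Θ * ((16 : ℝ) ^ m)⁻¹)))) + (4 * (4 + (4 : ℝ) ^ m * Ξ) * (1 + 16 * (1 + Cχ) / (klScale klE0 m) * 1) + (2 ^ 10 * Φ * (4 : ℝ) ^ m)))) ^ k := by
  have hδ0 : 0 ≤ (R.Gfr 0 * |U| * Θ * ((16 : ℝ) ^ m)⁻¹) := mul_nonneg (mul_nonneg (mul_nonneg (hR 0) (abs_nonneg U)) hΘ0) (by positivity)
  exact norm_iteratedFDeriv_defect_le_gevrey_small (klScale_pos_small m) hωΛ hX1 hC (fun l hl x => hXG l (hl.trans hk) x)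
    (EngineV8.contDiff_frameLevel μ _) (contDiff_evalM _) (add_nonneg (by norm_num) (mul_nonneg (by positivity) hΞ0))
    (mul_nonneg (mul_nonneg (by norm_num) hΦ0) (by positivity)) hδ0 q
    (fun i hi1 _ => frameLevel_flowFrame_jets_of_env hR hGS hQS hμ hX4 hP hT hmn hΞ0 hΞ hi1 q)
    (fun i _ => flowMismatch_jets_of_env hGS hQS hμ hX4 hP hT hmn hΘΦ i q)

end Tables

end Summit.HubbardSuperconductivity.HubbardSuperconductivity.Theorems.EngineV8

end
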